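import Literature.NumberTheory.ComplexMultiplication.CMAlgebraLatticeSemigroup
import HarnessLib

/-!
# The GROUPS `G(Λ)` of INVERTIBLE full lattices with order `Λ` in a CM-ALGEBRA `Y = L_1 ⊕ ⋯ ⊕ L_t`: orders are
# invertible, `L_1, L_2` invertible ⟹ `L_1L_2` invertible with `e_{L_1L_2} = e_{L_1}e_{L_2}`, i.e.
# `𝒪(L_1L_2) = 𝒪(L_1)𝒪(L_2)`, and `(L_1L_2)⁻¹ = L_1⁻¹L_2⁻¹`, `(L⁻¹)⁻¹ = L`; `G(Λ)` is closed under products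
# and inverses; `G(Λ_1) → G(Λ_1)Λ_2 ⊂ G(Λ_1Λ_2)` (Hertling–Larabi 2026 Thm. 4.2 = Dade–Taussky–Zassenhaus 1962,
# read in the semigroup `𝓛(Y)` of Lemma 5.5 ∕ Thm. 5.6)

Topic `Literature/NumberTheory/ComplexMultiplication`, namespace `Literature.NumberTheory.ComplexMultiplication`;
lane `lit-hodgefound` (Track 2 foundations library), Layer A3, seat p19 generation 31, row g31-#9 — sequel of
g31-#5 (`CMAlgebraLatticeSemigroup`: Thm. 5.6, «invertible» = `L·(𝒪(L):L) = 𝒪(L)` with `e_L = 𝒪(L) = L/L` and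
`L⁻¹ = 𝒪(L):L = (L/L)/L`; `idempotent_eq_div_self`, `eq_div_div_of_mul_eq_div_self`,
`div_div_self_of_mul_div_eq`, `inv_mul_div_eq_of_mul_div_eq`, `mul_isOrder_of_one_mem`).  It supplies the
lattice-level group structure behind `Pic(Λ) = G(Λ) ⊂ ICM_Λ` (the invertible `ε`-classes with order `Λ`, g31-#2 ∕
g31-#8): THEOREMS ONLY, no definition, no instance, no named fact (D-0026, net Literature debt `0`), no `sorry`.

## Source, VERBATIM

C. Hertling, K. Larabi, arXiv:2602.14973 (2026) [HertlingLarabi2026], held `paper:arxiv-2602.14973`, §4 (chunk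
p0009): «**Definition 4.1.** […] (b) Let `S` be a commutative semigroup. An element `a ∈ S` is called invertible if
an element `b ∈ S` and an element `c ∈ S` with `ab = c` and `ac = a` exist. (c) […] An element `c ∈ S` is called
idempotent if `cc = c`. **Theorem 4.2** (DTZ62). Let `S` be a commutative semigroup. (a) Let `a ∈ S` be invertible.
Then there is a unique element `c ∈ S` with the properties (`ac = a`, `∃ b ∈ S` with `ab = c`). It is called `e_a`.
It is idempotent. There is a unique element `b ∈ S` with the properties (`ab = e_a`, `be_a = b`). It is called
`a⁻¹`. It is invertible, and `e_{a⁻¹} = e_a`. (b) An idempotent `c ∈ S` is invertible with `e_c = c` and `c⁻¹ = c`.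
(c) Let `c ∈ S` be idempotent. The set `G(c) := {a ∈ S | a invertible with e_a = c}` is a group. It is a maximal
subgroup of `S`. […] (d) If `a, b ∈ S` are invertible, then `ab` is invertible with `e_{ab} = e_ae_b`. (e) Suppose
that `e_1, e_2 ∈ S` are both idempotent. Then `e_1e_2` is idempotent. The sets `G(e_1)e_2`, `G(e_2)e_1` and
`G(e_1)G(e_2)` are subgroups of `G(e_1e_2)`. […] *Proof:* […] (c) `c ∈ G(c)` because of (b). Any `a ∈ G(c)` has in
`G(c)` the inverse `a⁻¹`. For `a, b ∈ G(c)` `(ab)a⁻¹b⁻¹ = c` and `(ab)c = ab`, so also `ab ∈ G(c)` and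
`(ab)⁻¹ = a⁻¹b⁻¹`. Therefore `G(c)` is a group. […] (d) `(ab)a⁻¹b⁻¹ = e_ae_b`, `(e_ae_b)(ab) = ab`.»; §5 Thm. 5.6 (c)
(chunk p0012): «If this holds then `e_L = 𝒪(L)`, `L⁻¹ = 𝒪(L):L`».

## What is proved (`Y = ∏ᵢ Lᵢ`; `M`, `N : Submodule ℤ Y` full; «invertible» = `M·((M/M)/M) = M/M`)

* §1 THM 4.2 (b): **`mul_div_div_eq_of_one_mem`** (an order `Λ` — `1 ∈ Λ`, `ΛΛ ⊆ Λ` — is invertible, `Λ⁻¹ = Λ`: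
  `div_div_eq_self_of_one_mem`); THM 4.2 (a): **`div_div_div_eq_self_of_mul_div_eq`** (`(L⁻¹)⁻¹ = L`, i.e.
  `𝒪(L):(𝒪(L):L) = L` for invertible `L` — «`a = A:(A:a)`»).
* §2 THM 4.2 (d): **`div_self_mul_eq_of_mul_div_eq`** (`𝒪(L_1L_2) = 𝒪(L_1)𝒪(L_2)` for invertible `L_1, L_2`),
  **`mul_invertible_of_mul_div_eq`** (`L_1L_2` is invertible), **`inv_mul_eq_of_mul_div_eq`**
  (`(L_1L_2)⁻¹ = L_1⁻¹L_2⁻¹`).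
* §3 THM 4.2 (c), (e): `div_self_mul_eq_of_mul_div_eq_of_div_self_eq` (`G(Λ)` is closed under products: same order
  `Λ` ⟹ `𝒪(L_1L_2) = Λ`), `div_self_mul_order_eq` (`𝒪(LΛ_2) = 𝒪(L)Λ_2` and `LΛ_2` invertible for an order `Λ_2`:
  the map `G(e_1) → G(e_1)e_2 ⊂ G(e_1e_2)`), and the `ε`-class compatibility `units_smul_mul_units_smul`
  (`(uM)(vN) = (uv)(MN)`).

## References
* [HertlingLarabi2026] C. Hertling, K. Larabi, arXiv:2602.14973 (2026), §4 Def. 4.1, Thm. 4.2 (chunk p0009); §5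
  Lemma 5.5, Thm. 5.6 (chunks p0011–p0012). [cite: HertlingLarabi2026, §4 Thm. 4.2, chunk p0009]
* [DadeTausskyZassenhaus1962] E. C. Dade, O. Taussky, H. Zassenhaus, *On the theory of orders …*, Math. Ann. 148
  (1962) 31–64 (Thm. 4.2 is attributed to it). [cite: DadeTausskyZassenhaus1962, §1]
* [BuchmannLenstra1994] J. A. Buchmann, H. W. Lenstra, J. Théor. Nombres Bordeaux 6 (1994), (2.3) («if `ab = A`
  then `b = A : a`, and `a = A : b = A : (A : a)`»). [cite: BuchmannLenstra1994, §2 (2.3)]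
-/

noncomputable section

open scoped Classical Pointwise nonZeroDivisors NumberField
open Module NumberField Function

namespace Literature.NumberTheory.ComplexMultiplication

open Literature.NumberTheory.Automorphic

section InvertibleGroup

variable {t : Type} {L : t → Type} [∀ i, Field (L i)] [∀ i, NumberField (L i)]

/-! ## §1 Theorem 4.2 (a), (b): orders are invertible; `(L⁻¹)⁻¹ = L` -/

omit [∀ i, NumberField (L i)] in
/-- **THM 4.2 (b): an order `Λ` (`1 ∈ Λ`, `ΛΛ ⊆ Λ`) is invertible, `Λ·(𝒪(Λ):Λ) = 𝒪(Λ)`** (`𝒪(Λ) = Λ`, `Λ:Λ = Λ`).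
[cite: HertlingLarabi2026, §4 Thm. 4.2 (b), chunk p0009] -/
theorem mul_div_div_eq_of_one_mem {Λ : Submodule ℤ (Π i, L i)} (h1 : (1 : Π i, L i) ∈ Λ) (hΛ : Λ * Λ ≤ Λ) :
    Λ * ((Λ / Λ) / Λ) = Λ / Λ := by
  rw [div_self_eq_of_one_mem h1 hΛ, div_self_eq_of_one_mem h1 hΛ]
  exact le_antisymm hΛ fun x hx => by rw [← mul_one x]; exact Submodule.mul_mem_mul hx h1

omit [∀ i, NumberField (L i)] in
/-- **THM 4.2 (b): `c⁻¹ = c`** — the inverse `𝒪(Λ):Λ` of an order `Λ` is `Λ`. [cite: HertlingLarabi2026, §4 Thm. 4.2 (b), chunk p0009] -/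
theorem div_div_eq_self_of_one_mem {Λ : Submodule ℤ (Π i, L i)} (h1 : (1 : Π i, L i) ∈ Λ) (hΛ : Λ * Λ ≤ Λ) :
    (Λ / Λ) / Λ = Λ := by
  rw [div_self_eq_of_one_mem h1 hΛ, div_self_eq_of_one_mem h1 hΛ]

omit [∀ i, NumberField (L i)] in
/-- **THM 4.2 (a): `(L⁻¹)⁻¹ = L` — for an invertible `L`, `𝒪(L):(𝒪(L):L) = L`** («`a = A : b = A : (A : a)`»): `L`
is the inverse of `L⁻¹` in `G(𝒪(L))` (`L⁻¹L = 𝒪(L) = 𝒪(L⁻¹)`, `𝒪(L)L = L`), and inverses are unique.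
[cite: HertlingLarabi2026, §4 Thm. 4.2 (a) with §5 Thm. 5.6 (c), chunks p0009, p0012] [cite: BuchmannLenstra1994, §2 (2.3)] -/
theorem div_div_div_eq_self_of_mul_div_eq {M : Submodule ℤ (Π i, L i)} (h : M * ((M / M) / M) = M / M) :
    (M / M) / ((M / M) / M) = M := by
  have hO : ((M / M) / M) / ((M / M) / M) = M / M := div_div_self_of_mul_div_eq h
  have h1 : ((M / M) / M) * M = ((M / M) / M) / ((M / M) / M) := by rw [hO, mul_comm, h]
  have h2 : (((M / M) / M) / ((M / M) / M)) * M = M := by rw [hO, div_self_mul_self]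
  have h3 := eq_div_div_of_mul_eq_div_self h1 h2
  rw [hO] at h3
  exact h3.symm

/-! ## §2 Theorem 4.2 (d): products of invertible lattices -/

omit [∀ i, NumberField (L i)] in
/-- `(L_1L_2)·(L_1⁻¹L_2⁻¹) = 𝒪(L_1)𝒪(L_2)` for invertible `L_1`, `L_2` («`(ab)a⁻¹b⁻¹ = e_ae_b`»).
[cite: HertlingLarabi2026, §4 Thm. 4.2 (d) (proof), chunk p0009] -/
theorem mul_mul_inv_mul_inv_eq {M N : Submodule ℤ (Π i, L i)} (hM : M * ((M / M) / M) = M / M)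
    (hN : N * ((N / N) / N) = N / N) :
    (M * N) * (((M / M) / M) * ((N / N) / N)) = (M / M) * (N / N) := by
  rw [mul_mul_mul_comm, hM, hN]

/-- **THM 4.2 (d): `e_{ab} = e_ae_b` — for invertible `L_1`, `L_2`: `𝒪(L_1L_2) = 𝒪(L_1)𝒪(L_2)`.**
[cite: HertlingLarabi2026, §4 Thm. 4.2 (d), chunk p0009; §5 Lemma 5.3 (b) (5.3), chunk p0011] [cite: DadeTausskyZassenhaus1962, §1] -/
theorem div_self_mul_eq_of_mul_div_eq {M N : Submodule ℤ (Π i, L i)} (hMf : IsFullLattice (Π i, L i) M)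
    (hNf : IsFullLattice (Π i, L i) N) (hM : M * ((M / M) / M) = M / M) (hN : N * ((N / N) / N) = N / N) :
    (M * N) / (M * N) = (M / M) * (N / N) := by
  -- `E = 𝒪(L_1)𝒪(L_2)` is a full idempotent with `(L_1L_2)E = L_1L_2` and `(L_1L_2)(L_1⁻¹L_2⁻¹) = E`
  obtain ⟨h1E, hEE, -, -, -⟩ := mul_isOrder_of_one_mem (one_mem_div_self M) (div_self_mul_div_self_eq M).le
    (one_mem_div_self N) (div_self_mul_div_self_eq N).le
  have hE : ((M / M) * (N / N)) * ((M / M) * (N / N)) = (M / M) * (N / N) :=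
    le_antisymm hEE fun x hx => by
      rw [← one_mul x]
      exact Submodule.mul_mem_mul h1E hx
  have hME : (M * N) * ((M / M) * (N / N)) = M * N := by
    rw [mul_mul_mul_comm, mul_comm M (M / M), mul_comm N (N / N), div_self_mul_self, div_self_mul_self]
  exact (idempotent_eq_div_self (isFullLattice_mul (isFullLattice_div hMf hMf) (isFullLattice_div hNf hNf)) hE hME
    (mul_mul_inv_mul_inv_eq hM hN)).symm

/-- **THM 4.2 (d): the product of invertible lattices is invertible, `(L_1L_2)·(𝒪(L_1L_2):L_1L_2) = 𝒪(L_1L_2)`.**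
[cite: HertlingLarabi2026, §4 Thm. 4.2 (d), chunk p0009; §5 Thm. 5.6 (c), chunk p0012] -/
theorem mul_invertible_of_mul_div_eq {M N : Submodule ℤ (Π i, L i)} (hMf : IsFullLattice (Π i, L i) M)
    (hNf : IsFullLattice (Π i, L i) N) (hM : M * ((M / M) / M) = M / M) (hN : N * ((N / N) / N) = N / N) :
    (M * N) * (((M * N) / (M * N)) / (M * N)) = (M * N) / (M * N) :=
  mul_div_div_eq_of_exists_mul_eq ⟨((M / M) / M) * ((N / N) / N), by
    rw [mul_mul_inv_mul_inv_eq hM hN, div_self_mul_eq_of_mul_div_eq hMf hNf hM hN]⟩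

/-- **THM 4.2 (c)/(d): `(L_1L_2)⁻¹ = L_1⁻¹L_2⁻¹`**, i.e. `𝒪(L_1L_2):(L_1L_2) = (𝒪(L_1):L_1)(𝒪(L_2):L_2)` for
invertible `L_1`, `L_2` (uniqueness of the inverse in `G(e_{L_1L_2})`). [cite: HertlingLarabi2026, §4 Thm. 4.2 (a), (c) («`(ab)⁻¹ = a⁻¹b⁻¹`»), chunk p0009] -/
theorem inv_mul_eq_of_mul_div_eq {M N : Submodule ℤ (Π i, L i)} (hMf : IsFullLattice (Π i, L i) M)
    (hNf : IsFullLattice (Π i, L i) N) (hM : M * ((M / M) / M) = M / M) (hN : N * ((N / N) / N) = N / N) :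
    ((M * N) / (M * N)) / (M * N) = ((M / M) / M) * ((N / N) / N) := by
  have hO := div_self_mul_eq_of_mul_div_eq hMf hNf hM hN
  -- `𝒪(L⁻¹)L⁻¹ = L⁻¹` as `𝒪(L⁻¹) = 𝒪(L)`
  have h1 : (M / M) * ((M / M) / M) = (M / M) / M := by
    have h := div_self_mul_self ((M / M) / M)
    rwa [div_div_self_of_mul_div_eq hM] at h
  have h2 : (N / N) * ((N / N) / N) = (N / N) / N := by
    have h := div_self_mul_self ((N / N) / N)
    rwa [div_div_self_of_mul_div_eq hN] at h
  -- `(L_1L_2)(L_1⁻¹L_2⁻¹) = 𝒪(L_1L_2)` and `𝒪(L_1L_2)(L_1⁻¹L_2⁻¹) = L_1⁻¹L_2⁻¹`: uniqueness of the inverse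
  have h3 : (M * N) * (((M / M) / M) * ((N / N) / N)) = (M * N) / (M * N) := by
    rw [mul_mul_inv_mul_inv_eq hM hN, hO]
  have h4 : ((M * N) / (M * N)) * (((M / M) / M) * ((N / N) / N)) = ((M / M) / M) * ((N / N) / N) := by
    rw [hO, mul_mul_mul_comm, h1, h2]
  exact (eq_div_div_of_mul_eq_div_self h3 h4).symm

/-! ## §3 Theorem 4.2 (c), (e): the groups `G(Λ)` and the maps `G(Λ_1) → G(Λ_1)Λ_2` -/

/-- **THM 4.2 (c): `G(Λ)` is closed under products — invertible `L_1`, `L_2` with the same order `Λ` have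
`𝒪(L_1L_2) = Λ`** (and `L_1L_2` is invertible, `mul_invertible_of_mul_div_eq`; inverses stay in `G(Λ)` by g31-#5's
`div_div_self_of_mul_div_eq` ∕ `inv_mul_div_eq_of_mul_div_eq`). [cite: HertlingLarabi2026, §4 Thm. 4.2 (c), chunk p0009] [cite: DadeTausskyZassenhaus1962, §1] -/
theorem div_self_mul_eq_of_mul_div_eq_of_div_self_eq {M N Λ : Submodule ℤ (Π i, L i)}
    (hMf : IsFullLattice (Π i, L i) M) (hNf : IsFullLattice (Π i, L i) N) (hM : M * ((M / M) / M) = M / M)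
    (hN : N * ((N / N) / N) = N / N) (hMΛ : M / M = Λ) (hNΛ : N / N = Λ) : (M * N) / (M * N) = Λ := by
  rw [div_self_mul_eq_of_mul_div_eq hMf hNf hM hN, hMΛ, hNΛ, ← hMΛ, div_self_mul_div_self_eq]

/-- **THM 4.2 (e): for an invertible `L` and an order `Λ_2`, `LΛ_2` is invertible with `𝒪(LΛ_2) = 𝒪(L)Λ_2`** (the
map `G(e_1) → G(e_1)e_2 ⊂ G(e_1e_2)`, `a ↦ ae_2`). [cite: HertlingLarabi2026, §4 Thm. 4.2 (e), chunk p0009] -/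
theorem div_self_mul_order_eq {M Λ : Submodule ℤ (Π i, L i)} (hMf : IsFullLattice (Π i, L i) M)
    (hΛf : IsFullLattice (Π i, L i) Λ) (hM : M * ((M / M) / M) = M / M) (h1 : (1 : Π i, L i) ∈ Λ)
    (hΛ : Λ * Λ ≤ Λ) :
    (M * Λ) / (M * Λ) = (M / M) * Λ ∧ (M * Λ) * (((M * Λ) / (M * Λ)) / (M * Λ)) = (M * Λ) / (M * Λ) := by
  have hΛi := mul_div_div_eq_of_one_mem h1 hΛ
  refine ⟨?_, mul_invertible_of_mul_div_eq hMf hΛf hM hΛi⟩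
  rw [div_self_mul_eq_of_mul_div_eq hMf hΛf hM hΛi, div_self_eq_of_one_mem h1 hΛ]

omit [∀ i, NumberField (L i)] in
/-- **`(uM)(vN) = (uv)(MN)`**: the product of `𝓛(Y)` descends to the `ε`-classes `𝓔(Y)` («It induces the structure
of a commutative semigroup on `𝓔(A)`»), so `G(Λ)` descends to the group of invertible classes with order `Λ`.
[cite: HertlingLarabi2026, §5 Lemma 5.5, chunk p0012] -/
theorem units_smul_mul_units_smul (u v : (Π i, L i)ˣ) (M N : Submodule ℤ (Π i, L i)) :
    (u • M) * (v • N) = (u * v) • (M * N) := by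
  rw [← units_smul_mul, mul_comm M (v • N), ← units_smul_mul, mul_comm N M, ← mul_smul]

end InvertibleGroup

end Literature.NumberTheory.ComplexMultiplication
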